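import Summits.CriticalPhenomena.PercolationContinuityZ3.Theorems.PercNearOneGluingNoHeavyLowerTailSahiLatinZeroBottomProduct
import Summits.CriticalPhenomena.PercolationContinuityZ3.Theorems.PercNearOneGluingNoHeavyLowerTailSahiLatinZeroBottomCore
import Summits.CriticalPhenomena.PercolationContinuityZ3.Theorems.PercNearOneGluingNoHeavyLowerTailSahiLatinZeros

/-!
# `NoHeavyLowerTail` (crux stmt-CriticalPhenomena-4575), Sahi programme (prim-master-conj gen 50): the BLOCK-FACTOR EXPANSION of the four grid parts —
# lifting a zero-bottom instance `(P, b, Q, c)` on `[3]^κ` by an arbitrary FACTOR `A ⊆ [3]^W` on a private block (`P ↦ A × P`, `b ↦ A × b`, `Q, c` cylinders)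

Support file (`--supports stmt-CriticalPhenomena-4575`; one small definition (`fib`, the fibres of a set over the first block) + proofs, no `sorry`,
standard axioms).  Memo `run/shared/lean/prim/prim-l12/FROM-prim-master-conj-g50-GENERAL-CORE.md` §6.  Nothing here asserts the crux, Kahn's conjecture or (C¼).

THE MATHEMATICS.  gen 49's pairing lemmas peel ONE literal coordinate; here the coordinate is replaced by a whole block `W` carrying an ARBITRARY set
`A ⊆ [3]^W` (an up-set in the application): the lifted instance on `[3]^{W ⊕ κ}` is `P♯ = A × P`, `b♯ = A × b` (so `P′♯ = A × P′` — the prime and the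
step share the factor `A`), `Q♯ = [3]^W × Q`, `c♯ = [3]^W × c`.  Every Latin monomial of `Ψ` carries its `P/b` label at ONE point, which is either the
`F`-point (classes `SS`, `SO`) or another point (classes `OS`, `OO`); accordingly (with `fib H w = {x : (w,x) ∈ H}`, `k = |W|`, `N_A(w) = |A ∩ link w|`):
   `cSS(H; ♯) = Σ_w 2^k [w ∈ A] · cSS(fib H w)`,   `cSO(H; ♯) = Σ_w 2^k [w ∈ A] · cSO(fib H w)`,
   `cOS(H; ♯) = Σ_w N_A(w) · cOS(fib H w)`,        `cOO(H; ♯) = Σ_w N_A(w) · cOO(fib H w)`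
(`cSS_factor` … `cOO_factor`), proved pointwise from the block-independence dictionary of `…ZeroBottomProduct` (`dSS_factor` … `dOO_factor`) and the fibre
decomposition of sums (`sum_mem_eq_sum_fib`).  For `W` a single coordinate and `A = {2}`, `{1,2}`, `Ω` these are gen 49's twenty peel identities.  The
GENERALISED PAIRING LEMMA (a downward coupling of the `S`-weights `2^k·1_A` with the `O`-weights `N_A`, which exists by Harris + Hall) is the companion
file `…SahiLatinZeroBottomCoupling`. [this work]
-/

namespace Summit.CriticalPhenomena.PercolationContinuityZ3.Theorems.SahiLatin

open Finset

variable {W κ : Type*} [Fintype W] [DecidableEq W] [Fintype κ] [DecidableEq κ]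

/-! ## §1  Fibres over the first block -/

/-- The fibre of `H ⊆ [3]^{W ⊕ κ}` over the point `w` of the first block. [this work] -/
def fib (H : Finset (Pt (W ⊕ κ))) (w : Pt W) : Finset (Pt κ) := univ.filter fun x => Sum.elim w x ∈ H

omit [DecidableEq W] in
/-- Membership in a fibre. [this work] -/
@[simp] theorem mem_fib {H : Finset (Pt (W ⊕ κ))} {w : Pt W} {x : Pt κ} : x ∈ fib H w ↔ Sum.elim w x ∈ H := by
  simp [fib]

omit [Fintype W] [DecidableEq W] [Fintype κ] [DecidableEq κ] in
/-- Glued points compare blockwise. [this work] -/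
theorem elim_le_elim_iff {w w' : Pt W} {x x' : Pt κ} : Sum.elim w x ≤ Sum.elim w' x' ↔ w ≤ w' ∧ x ≤ x' := by
  constructor
  · intro h; exact ⟨fun a => h (Sum.inl a), fun b => h (Sum.inr b)⟩
  · rintro ⟨h1, h2⟩ i; cases i with
    | inl a => exact h1 a
    | inr b => exact h2 b

omit [DecidableEq W] in
/-- Fibres of an up-set are up-sets. [this work] -/
theorem isUpperSet_fib {H : Finset (Pt (W ⊕ κ))} (hH : IsUpperSet (H : Set (Pt (W ⊕ κ)))) (w : Pt W) :
    IsUpperSet ((fib H w : Finset (Pt κ)) : Set (Pt κ)) := by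
  intro x x' hxx' hx
  rw [mem_coe, mem_fib] at hx ⊢
  exact hH (elim_le_elim_iff.2 ⟨le_rfl, hxx'⟩) hx

omit [DecidableEq W] in
/-- Fibres of an up-set increase with the base point. [this work] -/
theorem fib_mono {H : Finset (Pt (W ⊕ κ))} (hH : IsUpperSet (H : Set (Pt (W ⊕ κ)))) {w w' : Pt W} (h : w ≤ w') : fib H w ⊆ fib H w' := by
  intro x hx
  rw [mem_fib] at hx ⊢
  exact hH (elim_le_elim_iff.2 ⟨h, le_rfl⟩) hx

omit [DecidableEq W] in
/-- Fibres are monotone in the set. [this work] -/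
theorem fib_subset_fib {H H' : Finset (Pt (W ⊕ κ))} (h : H ⊆ H') (w : Pt W) : fib H w ⊆ fib H' w := by
  intro x hx; rw [mem_fib] at hx ⊢; exact h hx

/-- A cylinder over the second block has constant fibres: `cylR X ⊆ H` gives `X ⊆ fib H w`. [this work] -/
theorem subset_fib_of_cylR_subset {X : Finset (Pt κ)} {H : Finset (Pt (W ⊕ κ))} (h : (cylR X : Finset (Pt (W ⊕ κ))) ⊆ H) (w : Pt W) :
    X ⊆ fib H w := by
  intro x hx; rw [mem_fib]; exact h (by simpa using hx)

/-- `A × X ⊆ H` gives `X ⊆ fib H w` for `w ∈ A`. [this work] -/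
theorem subset_fib_of_prod_subset {A : Finset (Pt W)} {X : Finset (Pt κ)} {H : Finset (Pt (W ⊕ κ))}
    (h : (cylL A : Finset (Pt (W ⊕ κ))) ∩ cylR X ⊆ H) {w : Pt W} (hw : w ∈ A) : X ⊆ fib H w := by
  intro x hx; rw [mem_fib]; exact h (by simp [hw, hx])

/-- **A sum over `H` is a sum over its fibres.** [this work] -/
theorem sum_mem_eq_sum_fib (H : Finset (Pt (W ⊕ κ))) (f : Pt (W ⊕ κ) → ℤ) :
    ∑ u ∈ H, f u = ∑ w : Pt W, ∑ x ∈ fib H w, f (Sum.elim w x) := by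
  have e : ∑ u ∈ H, f u = ∑ u, (if u ∈ H then f u else 0) := by
    rw [← sum_filter, filter_mem_eq_inter, univ_inter]
  rw [e, sum_pt_sum_eq]
  refine sum_congr rfl fun w _ => ?_
  rw [fib, sum_filter]

/-! ## §2  The lifted sets and the pointwise dictionary -/

/-- Cylinders over the second block commute with intersection. [this work] -/
theorem cylR_inter (X Y : Finset (Pt κ)) : (cylR (X ∩ Y) : Finset (Pt (W ⊕ κ))) = cylR X ∩ cylR Y := by
  ext u; simp

/-- `Λ_{A×X, Ω×Y}(u) = N_A(w)·Λ_{X,Y}(x)` (block independence for a mixed first argument). [this work] -/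
theorem Lam_prod_cylR (A : Finset (Pt W)) (X Y : Finset (Pt κ)) (u : Pt (W ⊕ κ)) :
    Lam ((cylL A : Finset (Pt (W ⊕ κ))) ∩ cylR X) (cylR Y) u = N A (fstPt u) * Lam X Y (sndPt u) := by
  rw [Lam, N, Lam, ← card_filter_link_prod]
  congr 1; ext y; simp [and_assoc]

section dict
variable (A : Finset (Pt W)) (P b Q c : Finset (Pt κ))

/-- `dSS` of the lifted instance: `2^k [w∈A] · dSS(x)`. [this work] -/
theorem dSS_factor (u : Pt (W ⊕ κ)) :
    dSS ((cylL A : Finset (Pt (W ⊕ κ))) ∩ cylR P) (cylL A ∩ cylR b) (cylR Q) (cylR c) u =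
      2 ^ Fintype.card W * ind A (fstPt u) * dSS P b Q c (sndPt u) := by
  unfold dSS
  rw [ind_inter, ind_inter, ind_cylL, ind_cylR, ind_cylR, ind_cylR, ind_cylR, Fintype.card_sum, pow_succ, pow_succ, pow_add]
  ring

/-- `dSO` of the lifted instance: `2^k [w∈A] · dSO(x)`. [this work] -/
theorem dSO_factor (u : Pt (W ⊕ κ)) :
    dSO ((cylL A : Finset (Pt (W ⊕ κ))) ∩ cylR P) (cylL A ∩ cylR b) (cylR Q) (cylR c) u =
      2 ^ Fintype.card W * ind A (fstPt u) * dSO P b Q c (sndPt u) := by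
  have dQ : (N (cylR Q : Finset (Pt (W ⊕ κ))) u : ℤ) = 2 ^ Fintype.card W * N Q (sndPt u) := by exact_mod_cast N_cylR Q u
  have dc : (N (cylR c : Finset (Pt (W ⊕ κ))) u : ℤ) = 2 ^ Fintype.card W * N c (sndPt u) := by exact_mod_cast N_cylR c u
  unfold dSO
  rw [ind_inter, ind_inter, ind_cylL, ind_cylR, ind_cylR, dQ, dc]
  ring

/-- `dOS` of the lifted instance: `N_A(w) · dOS(x)`. [this work] -/
theorem dOS_factor (u : Pt (W ⊕ κ)) :
    dOS ((cylL A : Finset (Pt (W ⊕ κ))) ∩ cylR P) (cylL A ∩ cylR b) (cylR Q) (cylR c) u =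
      (N A (fstPt u) : ℤ) * dOS P b Q c (sndPt u) := by
  have dP : (N ((cylL A : Finset (Pt (W ⊕ κ))) ∩ cylR P) u : ℤ) = N A (fstPt u) * N P (sndPt u) := by exact_mod_cast N_cylL_inter_cylR A P u
  have db : (N ((cylL A : Finset (Pt (W ⊕ κ))) ∩ cylR b) u : ℤ) = N A (fstPt u) * N b (sndPt u) := by exact_mod_cast N_cylL_inter_cylR A b u
  unfold dOS
  rw [ind_cylR, ind_cylR, dP, db]
  ring

/-- `dOO` of the lifted instance: `N_A(w) · dOO(x)`. [this work] -/
theorem dOO_factor (u : Pt (W ⊕ κ)) :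
    dOO ((cylL A : Finset (Pt (W ⊕ κ))) ∩ cylR P) (cylL A ∩ cylR b) (cylR Q) (cylR c) u =
      (N A (fstPt u) : ℤ) * dOO P b Q c (sndPt u) := by
  have l1 : (Lam ((cylL A : Finset (Pt (W ⊕ κ))) ∩ cylR P) (cylR c) u : ℤ) = N A (fstPt u) * Lam P c (sndPt u) := by
    exact_mod_cast Lam_prod_cylR A P c u
  have l2 : (Lam ((cylL A : Finset (Pt (W ⊕ κ))) ∩ cylR b) (cylR Q) u : ℤ) = N A (fstPt u) * Lam b Q (sndPt u) := by
    exact_mod_cast Lam_prod_cylR A b Q u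
  have l3 : (Lam ((cylL A : Finset (Pt (W ⊕ κ))) ∩ cylR b) (cylR c) u : ℤ) = N A (fstPt u) * Lam b c (sndPt u) := by
    exact_mod_cast Lam_prod_cylR A b c u
  have e1 : (cylR Q : Finset (Pt (W ⊕ κ))) ∩ (cylL A ∩ cylR b) = cylL A ∩ cylR (Q ∩ b) := by
    ext u; simp only [mem_inter, mem_cylR, mem_cylL]; tauto
  have e2 : (cylL A : Finset (Pt (W ⊕ κ))) ∩ cylR P ∩ cylR c = cylL A ∩ cylR (P ∩ c) := by
    ext u; simp only [mem_inter, mem_cylR, mem_cylL]; tauto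
  have e3 : (cylL A : Finset (Pt (W ⊕ κ))) ∩ cylR b ∩ cylR c = cylL A ∩ cylR (b ∩ c) := by
    ext u; simp only [mem_inter, mem_cylR, mem_cylL]; tauto
  have n1 : (N ((cylL A : Finset (Pt (W ⊕ κ))) ∩ cylR (Q ∩ b)) u : ℤ) = N A (fstPt u) * N (Q ∩ b) (sndPt u) := by
    exact_mod_cast N_cylL_inter_cylR A (Q ∩ b) u
  have n2 : (N ((cylL A : Finset (Pt (W ⊕ κ))) ∩ cylR (P ∩ c)) u : ℤ) = N A (fstPt u) * N (P ∩ c) (sndPt u) := by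
    exact_mod_cast N_cylL_inter_cylR A (P ∩ c) u
  have n3 : (N ((cylL A : Finset (Pt (W ⊕ κ))) ∩ cylR (b ∩ c)) u : ℤ) = N A (fstPt u) * N (b ∩ c) (sndPt u) := by
    exact_mod_cast N_cylL_inter_cylR A (b ∩ c) u
  unfold dOO
  rw [e1, e2, e3, l1, l2, l3, n1, n2, n3]
  ring

/-! ## §3  The expansions of the four parts -/

/-- **`cSS(H; ♯) = Σ_w 2^k [w∈A] cSS(fib H w)`.** [this work] -/
theorem cSS_factor (H : Finset (Pt (W ⊕ κ))) :
    cSS H ((cylL A : Finset (Pt (W ⊕ κ))) ∩ cylR P) (cylL A ∩ cylR b) (cylR Q) (cylR c) =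
      ∑ w : Pt W, 2 ^ Fintype.card W * ind A w * cSS (fib H w) P b Q c := by
  rw [cSS_eq_sum, sum_mem_eq_sum_fib]
  refine sum_congr rfl fun w _ => ?_
  rw [cSS_eq_sum, mul_sum]
  exact sum_congr rfl fun x _ => by rw [dSS_factor]; rfl

/-- **`cSO(H; ♯) = Σ_w 2^k [w∈A] cSO(fib H w)`.** [this work] -/
theorem cSO_factor (H : Finset (Pt (W ⊕ κ))) :
    cSO H ((cylL A : Finset (Pt (W ⊕ κ))) ∩ cylR P) (cylL A ∩ cylR b) (cylR Q) (cylR c) =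
      ∑ w : Pt W, 2 ^ Fintype.card W * ind A w * cSO (fib H w) P b Q c := by
  rw [cSO_eq_sum, sum_mem_eq_sum_fib]
  refine sum_congr rfl fun w _ => ?_
  rw [cSO_eq_sum, mul_sum]
  exact sum_congr rfl fun x _ => by rw [dSO_factor]; rfl

/-- **`cOS(H; ♯) = Σ_w N_A(w) cOS(fib H w)`.** [this work] -/
theorem cOS_factor (H : Finset (Pt (W ⊕ κ))) :
    cOS H ((cylL A : Finset (Pt (W ⊕ κ))) ∩ cylR P) (cylL A ∩ cylR b) (cylR Q) (cylR c) =
      ∑ w : Pt W, (N A w : ℤ) * cOS (fib H w) P b Q c := by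
  rw [cOS_eq_sum, sum_mem_eq_sum_fib]
  refine sum_congr rfl fun w _ => ?_
  rw [cOS_eq_sum, mul_sum]
  exact sum_congr rfl fun x _ => by rw [dOS_factor]; rfl

/-- **`cOO(H; ♯) = Σ_w N_A(w) cOO(fib H w)`.** [this work] -/
theorem cOO_factor (H : Finset (Pt (W ⊕ κ))) :
    cOO H ((cylL A : Finset (Pt (W ⊕ κ))) ∩ cylR P) (cylL A ∩ cylR b) (cylR Q) (cylR c) =
      ∑ w : Pt W, (N A w : ℤ) * cOO (fib H w) P b Q c := by
  rw [cOO_eq_sum, sum_mem_eq_sum_fib]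
  refine sum_congr rfl fun w _ => ?_
  rw [cOO_eq_sum, mul_sum]
  exact sum_congr rfl fun x _ => by rw [dOO_factor]; rfl

end dict

end Summit.CriticalPhenomena.PercolationContinuityZ3.Theorems.SahiLatin
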